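import Literature.RingTheory.PowerSeries.WeierstrassEvaluationAtMaximal
import HarnessLib

/-!
# Power series of residual order one over a complete local ring: `f = w·(X − b)`, `f` is prime, and
# `f ∣ g ↔ g(b) = 0`

Topic `RingTheory/PowerSeries`; sequel of `WeierstrassEvaluationAtMaximal.lean` (`maxEval`, `prime_X_sub_C`).  For a complete
local ring `(A, 𝔪)` and `f ∈ A⟦X⟧` with `f(0) ∈ 𝔪` and `[X¹]f ∈ A^×` (so the reduction `f̄ ∈ k⟦X⟧` has order EXACTLY one), the
Weierstrass preparation theorem (Washington Thm. 7.3; Mathlib `PowerSeries.exists_isWeierstrassFactorization`) factors `f` as a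
distinguished polynomial of degree one times a unit, i.e. **`f = (X − b)·w`, `b ∈ 𝔪`, `w ∈ A⟦X⟧^×`**.  Consequences: over a
domain `f` is PRIME (`prime_X_sub_C`), and divisibility by `f` is the vanishing of the value at `b`
(`X_sub_C_dvd_iff_maxEval_eq_zero`).  This is the algebra behind «an element `t·C g − N` of the two-variable Iwasawa algebra
`𝒪⟦X⟧⟦T⟧` whose `T`-coefficient is a unit generates a height-one PRIME» (de Shalit II §4.12: the auxiliary index `𝔞₁` with
`σ_{𝔞₁} − N𝔞₁` a prime of `Λ`).  Everything PROVED (0 sorry), no definitions, no named facts.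

* `map_residue_ne_zero_of_isUnit_coeff_one`, `order_map_residue_eq_one` — the reduction has order one;
* ★ `exists_eq_X_sub_C_mul_of_isUnit_coeff_one` — `f = (X − C b) * w`, `b ∈ 𝔪`, `IsUnit w`;
* ★ `prime_of_isUnit_coeff_one` (`A` a domain);
* ★ `exists_dvd_iff_maxEval_eq_zero` — one `b ∈ 𝔪` with `f = (X − b)·unit` and `∀ g, f ∣ g ↔ g(b) = 0`.

## References
* [Washington1997] L. C. Washington, *Introduction to Cyclotomic Fields*, 2nd ed. (1997), §7.1 Prop. 7.2, Thm. 7.3.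
* [BourbakiAC5to7] N. Bourbaki, *Algèbre commutative*, Ch. VII §3 no. 8, Prop. 5–6.
* [deShalit1987] E. de Shalit, *Iwasawa theory of elliptic curves with complex multiplication* (1987), Ch. II §4.12 (29)–(32).
-/

namespace Literature.RingTheory.PowerSeries

open _root_.PowerSeries

variable {A : Type*} [CommRing A] [IsLocalRing A] {f : A⟦X⟧}

/-! ### §1. Residual order one -/

/-- If `[X¹]f` is a unit then the reduction `f̄ ∈ k⟦X⟧` is non-zero. [cite: Washington1997, §7.1 Thm. 7.3] -/
theorem map_residue_ne_zero_of_isUnit_coeff_one (h1 : IsUnit (coeff 1 f)) : f.map (IsLocalRing.residue A) ≠ 0 := by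
  intro e
  have h := congrArg (coeff 1) e
  rw [coeff_map, map_zero] at h
  exact (IsLocalRing.residue_ne_zero_iff_isUnit _).mpr h1 h

/-- If `f(0) ∈ 𝔪` and `[X¹]f` is a unit, the reduction `f̄` has order exactly one. [cite: Washington1997, §7.1 Thm. 7.3] -/
theorem order_map_residue_eq_one (h0 : constantCoeff f ∈ IsLocalRing.maximalIdeal A) (h1 : IsUnit (coeff 1 f)) :
    (f.map (IsLocalRing.residue A)).order = 1 := by
  rw [← Nat.cast_one, order_eq_nat]
  refine ⟨?_, fun i hi ↦ ?_⟩
  · rw [coeff_map]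
    exact (IsLocalRing.residue_ne_zero_iff_isUnit _).mpr h1
  · obtain rfl : i = 0 := by omega
    rw [coeff_map, coeff_zero_eq_constantCoeff, (IsLocalRing.residue_eq_zero_iff _).mpr h0]

/-! ### §2. `f = (X − b)·w` -/

variable [IsAdicComplete (IsLocalRing.maximalIdeal A) A]

/-- ★ **A power series of residual order one is `(X − b)` times a unit**: if `f(0) ∈ 𝔪` and `[X¹]f ∈ A^×` over a complete local
ring `A`, then `f = (X − C b) * w` with `b ∈ 𝔪` and `w` a unit (Weierstrass preparation with a distinguished polynomial of degree
one, `X + p₀ = X − (−p₀)`). [cite: Washington1997, §7.1 Thm. 7.3] -/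
theorem exists_eq_X_sub_C_mul_of_isUnit_coeff_one (h0 : constantCoeff f ∈ IsLocalRing.maximalIdeal A) (h1 : IsUnit (coeff 1 f)) :
    ∃ b ∈ IsLocalRing.maximalIdeal A, ∃ w : A⟦X⟧, IsUnit w ∧ f = (X - C b) * w := by
  have hf := map_residue_ne_zero_of_isUnit_coeff_one h1
  obtain ⟨p, w, H⟩ := f.exists_isWeierstrassFactorization hf
  have hdeg : p.natDegree = 1 := by
    rw [H.natDegree_eq_toNat_order_map, order_map_residue_eq_one h0 h1]; rfl
  have hp : p = Polynomial.X + Polynomial.C (p.coeff 0) := H.isDistinguishedAt.monic.eq_X_add_C hdeg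
  have hb : p.coeff 0 ∈ IsLocalRing.maximalIdeal A := H.isDistinguishedAt.mem (by rw [hdeg]; exact Nat.zero_lt_one)
  refine ⟨-p.coeff 0, neg_mem hb, w, H.isUnit, ?_⟩
  rw [H.eq_mul, map_neg, sub_neg_eq_add]
  conv_lhs => rw [hp]
  rw [Polynomial.coe_add, Polynomial.coe_X, Polynomial.coe_C]

/-- ★ **A power series of residual order one over a complete local DOMAIN is prime** (an associate of the prime `X − b`).
[cite: BourbakiAC5to7, Ch. VII §3 no. 8] [cite: Washington1997, §7.1 Thm. 7.3] -/
theorem prime_of_isUnit_coeff_one [IsDomain A] (h0 : constantCoeff f ∈ IsLocalRing.maximalIdeal A) (h1 : IsUnit (coeff 1 f)) :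
    Prime f := by
  obtain ⟨b, hb, w, hw, rfl⟩ := exists_eq_X_sub_C_mul_of_isUnit_coeff_one h0 h1
  exact (associated_mul_unit_right (X - C b) w hw).prime (prime_X_sub_C hb)

/-- ★ **Divisibility by a series of residual order one is the vanishing of a value**: there is `b ∈ 𝔪` with `f = (X − b)·unit`
and, for every `g`, `f ∣ g ↔ g(b) = 0` (`g(b) = maxEval`). [cite: Washington1997, §7.1 Prop. 7.2, Thm. 7.3] -/
theorem exists_dvd_iff_maxEval_eq_zero (h0 : constantCoeff f ∈ IsLocalRing.maximalIdeal A) (h1 : IsUnit (coeff 1 f)) :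
    ∃ (b : A) (hb : b ∈ IsLocalRing.maximalIdeal A), (∃ w : A⟦X⟧, IsUnit w ∧ f = (X - C b) * w) ∧
      ∀ g : A⟦X⟧, f ∣ g ↔ maxEval hb g = 0 := by
  obtain ⟨b, hb, w, hw, rfl⟩ := exists_eq_X_sub_C_mul_of_isUnit_coeff_one h0 h1
  refine ⟨b, hb, ⟨w, hw, rfl⟩, fun g ↦ ?_⟩
  rw [← X_sub_C_dvd_iff_maxEval_eq_zero hb, hw.mul_right_dvd]

end Literature.RingTheory.PowerSeries
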